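import Literature.NumberTheory.Transcendental.SemialgebraicMapsProofs
import Literature.NumberTheory.Transcendental.KZIntervalPeriodProofs
import Mathlib

/-! BC5-style special case for `stub_monomialPatches` / X₁ typing: n = 1, σ = C = (0,1), p = 1, q = X₀
(density `1/x`, NOT integrable — irrelevant for the geometric stub): one chart `φ = id`, `u = 1`,
`a = -1`. Shows every clause of the stub is meetable by the intended kind of witness (no sorry). -/

noncomputable section
open MeasureTheory Set
open Literature.NumberTheory.Transcendental Literature.ModelTheory.ExponentialFields

namespace Summit.KontsevichZagierPeriods.VeryGoodTransfer.MonomialPatchesDim1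

theorem isSemialgebraic_cube1 : IsSemialgebraic ℚ {x : Fin 1 → ℝ | ∀ j, 0 < x j ∧ x j < 1} := by
  have : {x : Fin 1 → ℝ | ∀ j, 0 < x j ∧ x j < 1} =
      ⋂ j ∈ (Finset.univ : Finset (Fin 1)),
        ({x : Fin 1 → ℝ | 0 < MvPolynomial.aeval x (MvPolynomial.X j : MvPolynomial (Fin 1) ℚ)} ∩
          {x : Fin 1 → ℝ | 0 < MvPolynomial.aeval x (1 - MvPolynomial.X j : MvPolynomial (Fin 1) ℚ)}) := by
    ext x; simp [sub_pos]
  rw [this]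
  exact IsSemialgebraic.biInter _ _ fun j _ =>
    (isSemialgebraic_setOf_eval_pos _).inter (isSemialgebraic_setOf_eval_pos _)

/-- The `n = 1` instance of the conclusion of `stub_monomialPatches` at `σ = C`, `p = 1`, `q = X₀`. -/
theorem dim1_instance :
    ∃ (k : ℕ) (φ : Fin k → (Fin 1 → ℝ) → (Fin 1 → ℝ)) (φ' : Fin k → (Fin 1 → ℝ) → (Fin 1 → ℝ) →L[ℝ] (Fin 1 → ℝ)) (u : Fin k → (Fin 1 → ℝ) → ℝ) (U : Fin k → Set (Fin 1 → ℝ)) (a : Fin k → Fin 1 → ℤ), (∀ i, Literature.NumberTheory.Transcendental.IsSemialgebraicMapOn ℚ {x : Fin 1 → ℝ | ∀ j, 0 < x j ∧ x j < 1} (φ i) ∧ (∀ x ∈ {x : Fin 1 → ℝ | ∀ j, 0 < x j ∧ x j < 1}, HasFDerivWithinAt (φ i) (φ' i x) {x : Fin 1 → ℝ | ∀ j, 0 < x j ∧ x j < 1} x) ∧ Set.InjOn (φ i) {x : Fin 1 → ℝ | ∀ j, 0 < x j ∧ x j < 1} ∧ φ i '' {x : Fin 1 → ℝ | ∀ j,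 0 < x j ∧ x j < 1} ⊆ {x : Fin 1 → ℝ | ∀ j, 0 < x j ∧ x j < 1} ∧ IsOpen (U i) ∧ closure {x : Fin 1 → ℝ | ∀ j, 0 < x j ∧ x j < 1} ⊆ U i ∧ ContDiffOn ℝ 1 (u i) (U i) ∧ (∀ x ∈ U i, u i x ≠ 0) ∧ Literature.NumberTheory.Transcendental.IsSemialgebraicFunOn ℚ {x : Fin 1 → ℝ | ∀ j, 0 < x j ∧ x j < 1} (u i) ∧ ∀ x ∈ {x : Fin 1 → ℝ | ∀ j, 0 < x j ∧ x j < 1}, MvPolynomial.aeval (φ i x) (1 : MvPolynomial (Fin 1) ℚ) / MvPolynomial.aeval (φ i x) (MvPolynomial.X 0 : MvPolynomial (Fin 1) ℚ) * |(φ' i x).det| = u i x * ∏ j, x j ^ (a i j)) ∧ MeasureTheory.volume ({x : Fin 1 → ℝ | ∀ j, 0 < x j ∧ x j < 1} \ ⋃ i, φ i '' {x : Fin 1 → ℝ | ∀ j, 0 < x j ∧ x j < 1}) = 0 := by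
  have hCs := isSemialgebraic_cube1
  refine ⟨1, fun _ => id, fun _ _ => ContinuousLinearMap.id ℝ (Fin 1 → ℝ), fun _ _ => 1, fun _ => Set.univ,
    fun _ _ => -1, fun i => ⟨?_, ?_, ?_, ?_, ?_, ?_, ?_, ?_, ?_, ?_⟩, ?_⟩
  · exact isSemialgebraicMapOn_id hCs
  · intro x _; exact hasFDerivWithinAt_id x _
  · exact injOn_id _
  · simp
  · exact isOpen_univ
  · exact subset_univ _
  · exact contDiffOn_const
  · intro x _; exact one_ne_zero
  · simpa using isSemialgebraicFunOn_ratCast hCs 1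
  · intro x hx
    have hdet : (ContinuousLinearMap.id ℝ (Fin 1 → ℝ)).det = 1 := by
      rw [ContinuousLinearMap.det, ContinuousLinearMap.coe_id, LinearMap.det_id]
    simp [hdet]
  · simp only [Set.image_id, Set.iUnion_const, Set.diff_self, measure_empty]

end Summit.KontsevichZagierPeriods.VeryGoodTransfer.MonomialPatchesDim1
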